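import Summits.QuantumAdvantage.QuantumAdvantage.Theorems.SupportDialResidueCertificateB

/-! # SupportDial residue certificate — part C (decomp-qadv-lens-1 g7, node «ResidueDial» rev 5)

§6c part 1: dictionary `sigmaSum`/`rot3`/`jB` ↔ block sums; rotation of the ring (`rotF`, `inKernel_rot`). -/

set_option linter.dupNamespace false
set_option linter.style.longLine false
set_option linter.unusedVariables false

open Finset
open Literature.Computability.QuantumComplexity.RingHLF
open Literature.Computability.MetaComplexity.Smolensky (CubeFn mono lowDeg)
open Summit.QuantumAdvantage.AdviceFreeQNC0

namespace Summit.QuantumAdvantage.QuantumAdvantage.Theorems.SupportDialResidueCertificate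

/-! ## §6c `TwoBlockLaw2` PROVED (0 sorry) for EVERY odd `k ≥ 3` — hence `MomentLaw2` is a THEOREM
The dictionary: (A) `sigmaSum (ofFn γ) = Σ_i (−1)^{#zeros after i}` (the tree's docstring formula, `sigmaSum_ofFn_eq`),
which on the odd class of an odd ring equals `E₀ − O₀` (`sigmaSum_eq_blk`; parity bookkeeping `zerosAfter_parity`), while
`rot3 = E₀ + O₀` (`rot3_eq_blk`); the tree's structure theorem `RingKernel.kernel_odd` gives `J₀ = (fixVec S).2 = [S ≠ 0]`
(`jB_zero_eq`).  (B) ROTATION to base `j` (`rotF`, `inKernel_rot`, `jB_rot`, `psum_rot`, `blk_rot`) and the PARITY TRANSPORT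
`psum β j d ≡ pre β j + psum β 0 (j+d)` (`psum_parity`, two cases: the cyclic interval wraps or not), giving
`E_j + O_j = (−1)^{pre} · rot3 β` (`blk_sum_eq`).  (C) the 9-case identity `[E+O ≠ 0]·[E−O ≠ 0] = [E = 0] ⊕ [O = 0]` over
`(ℤ/3)²` (`decide`). -/
section TwoBlockProof

/-- ResidueDial helper `neg_one_pow_congr` (lens-1 g7 ResidueDial certificate; see the enclosing section docstring). -/
theorem neg_one_pow_congr {a b : ℕ} (h : a % 2 = b % 2) : (-1 : ZMod 3) ^ a = (-1 : ZMod 3) ^ b := by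
  rw [neg_one_pow_eq_sgn, neg_one_pow_eq_sgn, h]

/-! ### A. The base-0 dictionary: `sigmaSum` of the word of `γ` in closed form -/

/-- number of zeros of `γ` strictly after position `i` -/
def zerosAfter {k : ℕ} (γ : Fin k → Bool) (i : Fin k) : ℕ :=
  (univ.filter fun l : Fin k => i < l ∧ γ l = false).card

/-- A2: `sigmaSum (ofFn γ) = Σ_i (−1)^{#zeros after i}` (the tree's docstring formula, proved). -/
theorem sigmaSum_ofFn_eq : ∀ {k : ℕ} (γ : Fin k → Bool),
    sigmaSum (List.ofFn γ) = ∑ i : Fin k, (-1 : ZMod 3) ^ zerosAfter γ i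
  | 0, γ => by simp [sigmaSum]
  | k + 1, γ => by
    rw [List.ofFn_succ, sigmaSum, Fin.sum_univ_succ]
    have ih := sigmaSum_ofFn_eq (fun i : Fin k => γ i.succ)
    -- the tail sum
    have htail : ∀ i : Fin k, zerosAfter γ i.succ = zerosAfter (fun l : Fin k => γ l.succ) i := by
      intro i
      unfold zerosAfter
      rw [Finset.card_filter, Finset.card_filter, Fin.sum_univ_succ]
      simp [Fin.succ_lt_succ_iff]
    -- the head term: zeros after position 0 = zeros of the tail
    have hhead : zerosAfter γ 0 = (univ.filter fun l : Fin k => γ l.succ = false).card := by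
      unfold zerosAfter
      rw [Finset.card_filter, Finset.card_filter, Fin.sum_univ_succ]
      simp [Fin.succ_pos]
    have hsign : (if reflBit (List.ofFn fun i : Fin k => γ i.succ) then (-1 : ZMod 3) else 1) =
        (-1 : ZMod 3) ^ zerosAfter γ 0 := by
      rw [hhead, neg_one_pow_eq_sgn]
      by_cases h : reflBit (List.ofFn fun i : Fin k => γ i.succ) = true
      · rw [if_pos h, if_pos (Nat.odd_iff.1 ((reflBit_ofFn_iff _).1 h))]
      · have h' : ¬ Odd ((univ.filter fun l : Fin k => γ l.succ = false).card) := fun ho => h ((reflBit_ofFn_iff _).2 ho)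
        rw [if_neg h, if_neg (fun hm => h' (Nat.odd_iff.2 hm))]
    rw [ih, hsign, add_comm]
    congr 1
    exact Finset.sum_congr rfl fun i _ => by rw [htail]

/-- `#{l ≤ i}` in `Fin k` is `i+1`. -/
theorem card_filter_le {k : ℕ} (i : Fin k) : (univ.filter fun l : Fin k => l ≤ i).card = i.val + 1 := by
  have : (univ.filter fun l : Fin k => l ≤ i) = Finset.Iic i := by ext l; simp
  rw [this, Fin.card_Iic]

section Rot
variable {k : ℕ} [NeZero k]

/-- A3: on the odd class of an odd ring, `(−1)^{#zeros after i} = (−1)^{i + psum γ 0 i}`. -/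
theorem zerosAfter_parity (hko : k % 2 = 1) (γ : Fin k → Bool) (hγ : oddZ γ = true) (i : Fin k) :
    zerosAfter γ i % 2 = (i.val + psum γ 0 i.val) % 2 := by
  -- counts
  have c1 : (univ.filter fun l : Fin k => l ≤ i).card + (univ.filter fun l : Fin k => ¬ l ≤ i).card = k := by
    rw [Finset.card_filter_add_card_filter_not, Finset.card_univ, Fintype.card_fin]
  rw [card_filter_le] at c1
  -- split {i < l} by γ
  have c2 : (univ.filter fun l : Fin k => i < l ∧ γ l = false).card +
      (univ.filter fun l : Fin k => i < l ∧ γ l = true).card = (univ.filter fun l : Fin k => ¬ l ≤ i).card := by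
    rw [← Finset.card_union_of_disjoint]
    · congr 1; ext l; simp only [Finset.mem_union, Finset.mem_filter, Finset.mem_univ, true_and, not_le]
      cases γ l <;> simp
    · exact Finset.disjoint_filter.2 fun l _ h1 h2 => by rw [h1.2] at h2; exact Bool.false_ne_true h2.2
  -- split ones by position
  have c3 : (univ.filter fun l : Fin k => l ≤ i ∧ γ l = true).card +
      (univ.filter fun l : Fin k => i < l ∧ γ l = true).card = (univ.filter fun l : Fin k => γ l = true).card := by
    rw [← Finset.card_union_of_disjoint]
    · congr 1; ext l; simp only [Finset.mem_union, Finset.mem_filter, Finset.mem_univ, true_and]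
      constructor
      · rintro (⟨-, h⟩ | ⟨-, h⟩) <;> exact h
      · intro h; by_cases hl : l ≤ i; exact Or.inl ⟨hl, h⟩; exact Or.inr ⟨not_le.1 hl, h⟩
    · exact Finset.disjoint_filter.2 fun l _ h1 h2 => absurd h2.1 (not_lt.2 h1.1)
  have c4 : (univ.filter fun b : Fin k => γ b = false).card + (univ.filter fun b : Fin k => γ b = true).card = k := by
    have h := Finset.card_filter_add_card_filter_not (s := (univ : Finset (Fin k))) (fun b : Fin k => γ b = false)
    have hneg : (univ.filter fun b : Fin k => ¬ γ b = false) = univ.filter fun b : Fin k => γ b = true :=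
      Finset.filter_congr fun b _ => by simp
    rw [hneg, Finset.card_univ, Fintype.card_fin] at h
    exact h
  have hz : (univ.filter fun b : Fin k => γ b = false).card % 2 = 1 := by
    unfold oddZ at hγ; exact of_decide_eq_true hγ
  have hp : psum γ 0 i.val = (univ.filter fun l : Fin k => l ≤ i ∧ γ l = true).card := by
    unfold psum; congr 1
    refine Finset.filter_congr fun l _ => ?_
    rw [sub_zero]; exact Iff.rfl
  unfold zerosAfter
  rw [hp]
  omega

/-- A3': `sigmaSum (ofFn γ) = E₀ − O₀` on the odd class of an odd ring. -/
theorem sigmaSum_eq_blk (hko : k % 2 = 1) (γ : Fin k → Bool) (hγ : oddZ γ = true) :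
    sigmaSum (List.ofFn γ) = blk γ 0 0 - blk γ 0 1 := by
  rw [sigmaSum_ofFn_eq]
  have h1 : (∑ i : Fin k, (-1 : ZMod 3) ^ zerosAfter γ i) =
      ∑ d ∈ Finset.range k, (-1 : ZMod 3) ^ d * (-1 : ZMod 3) ^ psum γ 0 d := by
    rw [← Fin.sum_univ_eq_sum_range (fun d => (-1 : ZMod 3) ^ d * (-1 : ZMod 3) ^ psum γ 0 d)]
    refine Finset.sum_congr rfl fun i _ => ?_
    rw [← pow_add]
    exact neg_one_pow_congr (zerosAfter_parity hko γ hγ i)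
  rw [h1, blk, blk, ← Finset.sum_filter_add_sum_filter_not (Finset.range k) (fun d => d % 2 = 0), sub_eq_add_neg,
    ← Finset.sum_neg_distrib]
  have hne : (Finset.range k).filter (fun d => ¬ d % 2 = 0) = (Finset.range k).filter (fun d => d % 2 = 1) :=
    Finset.filter_congr fun d _ => by omega
  rw [hne]
  congr 1
  · refine Finset.sum_congr rfl fun d hd => ?_
    rw [(Finset.mem_filter.1 hd).2 |> fun h => (Nat.even_iff.2 h).neg_one_pow, one_mul]
  · refine Finset.sum_congr rfl fun d hd => ?_
    rw [(Finset.mem_filter.1 hd).2 |> fun h => (Nat.odd_iff.2 h).neg_one_pow, neg_one_mul]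

/-- A4: `rot3 γ = E₀ + O₀`. -/
theorem rot3_eq_blk (γ : Fin k → Bool) : rot3 γ = blk γ 0 0 + blk γ 0 1 := by
  unfold rot3 blk
  have h1 : (∑ i : Fin k, (-1 : ZMod 3) ^ (univ.filter fun j : Fin k => j ≤ i ∧ γ j = true).card) =
      ∑ d ∈ Finset.range k, (-1 : ZMod 3) ^ psum γ 0 d := by
    rw [← Fin.sum_univ_eq_sum_range (fun d => (-1 : ZMod 3) ^ psum γ 0 d)]
    refine Finset.sum_congr rfl fun i _ => ?_
    unfold psum; congr 2
    refine Finset.filter_congr fun l _ => ?_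
    rw [sub_zero]; exact Iff.rfl
  rw [h1, ← Finset.sum_filter_add_sum_filter_not (Finset.range k) (fun d => d % 2 = 0)]
  have hne : (Finset.range k).filter (fun d => ¬ d % 2 = 0) = (Finset.range k).filter (fun d => d % 2 = 1) :=
    Finset.filter_congr fun d _ => by omega
  rw [hne]

/-- `(fixVec S).2 = [S ≠ 0]`. -/
theorem fixVec_snd : ∀ S : ZMod 3, (fixVec S).2 = decide (S ≠ 0) := by decide

/-- A5: on the odd class (`k ≥ 3`), `J_0 = [sigmaSum ≠ 0]`. -/
theorem jB_zero_eq (hk : 3 ≤ k) (γ : Fin k → Bool) (hodd : reflBit (List.ofFn γ) = true) :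
    jB γ 0 = decide (sigmaSum (List.ofFn γ) ≠ 0) := by
  have hKV0 : kernelVec γ (fixVec (sigmaSum (List.ofFn γ))) 0 = decide (sigmaSum (List.ofFn γ) ≠ 0) := by
    rw [kernelVec]; simp only [Fin.val_zero, iter_zero]; exact fixVec_snd _
  by_cases hS0 : sigmaSum (List.ofFn γ) ≠ 0
  · have hfilter : (univ.filter fun v : Fin k → Bool => InKernel γ v ∧ v 0 = true) =
        {kernelVec γ (fixVec (sigmaSum (List.ofFn γ)))} := by
      ext v
      simp only [Finset.mem_filter, Finset.mem_univ, true_and, Finset.mem_singleton]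
      rw [kernel_odd hk γ hodd v]
      constructor
      · rintro ⟨(rfl | rfl), hv⟩
        · exact absurd hv Bool.false_ne_true
        · rfl
      · rintro rfl; exact ⟨Or.inr rfl, by rw [hKV0]; exact decide_eq_true hS0⟩
    unfold jB; rw [hfilter, Finset.card_singleton]; simp [hS0]
  · have hfilter : (univ.filter fun v : Fin k → Bool => InKernel γ v ∧ v 0 = true) = ∅ := by
      ext v
      simp only [Finset.mem_filter, Finset.mem_univ, true_and, Finset.notMem_empty, iff_false, not_and]
      rw [kernel_odd hk γ hodd v]
      rintro (rfl | rfl)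
      · exact Bool.false_ne_true
      · rw [hKV0]; simp only [decide_eq_true_eq]; exact hS0
    unfold jB; rw [hfilter, Finset.card_empty]
    simp only [ne_eq, not_not] at hS0; simp [hS0]

/-! ### B. Rotation to base `j` -/

/-- rotate a ring function: `rotF j f l = f (l + j)` -/
def rotF {α : Type*} (j : Fin k) (f : Fin k → α) : Fin k → α := fun l => f (l + j)

omit [NeZero k] in
/-- ResidueDial helper `nxt_add` (lens-1 g7 ResidueDial certificate; see the enclosing section docstring). -/
theorem nxt_add (l j : Fin k) : nxt (l + j) = nxt l + j := by
  apply Fin.ext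
  simp only [nxt, Fin.val_add]
  rw [Nat.mod_add_mod, Nat.mod_add_mod]
  congr 1; omega

/-- ResidueDial helper `prv_add` (lens-1 g7 ResidueDial certificate; see the enclosing section docstring). -/
theorem prv_add (l j : Fin k) : prv (l + j) = prv l + j := by
  apply Fin.ext
  simp only [prv, Fin.val_add]
  have hk : 1 ≤ k := Nat.one_le_iff_ne_zero.2 (NeZero.ne k)
  rw [Nat.mod_add_mod, show (l.val + j.val) % k + k - 1 = (l.val + j.val) % k + (k - 1) by omega, Nat.mod_add_mod,
    show l.val + k - 1 = l.val + (k - 1) by omega]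
  congr 1; omega

/-- ResidueDial helper `inKernel_rot` (lens-1 g7 ResidueDial certificate; see the enclosing section docstring). -/
theorem inKernel_rot (j : Fin k) (β v : Fin k → Bool) : InKernel (rotF j β) (rotF j v) ↔ InKernel β v := by
  unfold InKernel rotF
  constructor
  · intro h b
    have := h (b - j)
    rw [← prv_add, ← nxt_add, sub_add_cancel] at this
    exact this
  · intro h b
    have := h (b + j)
    rw [← prv_add, ← nxt_add]
    exact this
end Rot

end TwoBlockProof

end Summit.QuantumAdvantage.QuantumAdvantage.Theorems.SupportDialResidueCertificate
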